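import Mathlib
import Summits.KontsevichZagierPeriods.Zeta5Search.DenomLaw.LongProfilesAllPath
import Summits.KontsevichZagierPeriods.Zeta5Search.DenomLaw.Profile14PathA
import Summits.KontsevichZagierPeriods.Zeta5Search.DenomLaw.Profile14PathB
import Summits.KontsevichZagierPeriods.Zeta5Search.DenomLaw.Profile13PathA
import Summits.KontsevichZagierPeriods.Zeta5Search.DenomLaw.Profile13PathB
import Summits.KontsevichZagierPeriods.Zeta5Search.DenomLaw.Profile12PathA
import Summits.KontsevichZagierPeriods.Zeta5Search.DenomLaw.Profile12PathB
import Summits.KontsevichZagierPeriods.Zeta5Search.DenomLaw.Profile12PathC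
import Summits.KontsevichZagierPeriods.Zeta5Search.DenomLaw.Profile11PathA
import Summits.KontsevichZagierPeriods.Zeta5Search.DenomLaw.Profile11PathB
import Summits.KontsevichZagierPeriods.Zeta5Search.DenomLaw.Profile11PathC
import Summits.KontsevichZagierPeriods.Zeta5Search.DenomLaw.Profile10PathA
import Summits.KontsevichZagierPeriods.Zeta5Search.DenomLaw.Profile10PathB
import Summits.KontsevichZagierPeriods.Zeta5Search.DenomLaw.Profile10PathC
import Summits.KontsevichZagierPeriods.Zeta5Search.DenomLaw.Profile9PathA
import Summits.KontsevichZagierPeriods.Zeta5Search.DenomLaw.Profile9PathB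
import Summits.KontsevichZagierPeriods.Zeta5Search.DenomLaw.Profile9PathC
import Summits.KontsevichZagierPeriods.Zeta5Search.DenomLaw.Profile8PathA
import Summits.KontsevichZagierPeriods.Zeta5Search.DenomLaw.Profile8PathB
import Summits.KontsevichZagierPeriods.Zeta5Search.DenomLaw.Profile7PathA
import Summits.KontsevichZagierPeriods.Zeta5Search.DenomLaw.Profile7PathB
import Summits.KontsevichZagierPeriods.Zeta5Search.DenomLaw.Profile7PathC
import Summits.KontsevichZagierPeriods.Zeta5Search.DenomLaw.Profile6PathA
import Summits.KontsevichZagierPeriods.Zeta5Search.DenomLaw.Profile6PathB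
import Summits.KontsevichZagierPeriods.Zeta5Search.DenomLaw.Profile6PathC
import Summits.KontsevichZagierPeriods.Zeta5Search.DenomLaw.Profile5PathA
import Summits.KontsevichZagierPeriods.Zeta5Search.DenomLaw.Profile5PathB
import Summits.KontsevichZagierPeriods.Zeta5Search.DenomLaw.ProfileLe4PathA
import Summits.KontsevichZagierPeriods.Zeta5Search.DenomLaw.ProfileLe4PathB
import Summits.KontsevichZagierPeriods.Zeta5Search.DenomLaw.Profile4b3aPath
import Summits.KontsevichZagierPeriods.Zeta5Search.DenomLaw.PathAccountingShallow
import Summits.KontsevichZagierPeriods.Zeta5Search.CasoratianLawNoMultipole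
import HarnessLib

/-!
# ζ(5) search — THE a = 7 ASSEMBLY: `PathAccountingFirstPeriod` for EVERY sorted parameter vector with all seven parameters long, every direction, every depth (DENOM-LAW D1, prover-d1 gen 23)

Cell `pub-zeta5` (HONEST FRAMING: systematic search; no irrationality claim unless certified), TRACK «DENOM-LAW» D1 prover seat (denom-prover-d1
gen 23, `HOME/denom-law/prover-d1/ATTEMPT-23.md`).  The node `DenomLaw.PathAccountingFirstPeriod` (`@[conjecture]`, ∀ b) restricted to the
a = 7 STRATUM of the first period — every sorted `b` in the Brown–Zudilin polytope with `p ≤ b₇` (all seven parameters reach `p`; the stratum holds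
8,878 / 149,437 / 449,805 of the first-period instances at p = 7 / 11 / 13) — is a THEOREM: **`pathAccounting_a7_all`** (every direction `j`) and
**`pathAccountingFirstPeriod_a7_all`** (the node's binders VERBATIM plus ONLY `p ≤ b₇`).  PROOF = a decision tree of depth 6 over pair-block ORDER
conditions `b₀ < p + b_i + b_k` / `p + b_i + b_k ≤ b₀`: for a sorted vector the long pair blocks form an up-set of the pair poset (Gale order on the
2-subsets of `{1,…,7}`), which has exactly 64 up-sets, and six threshold tests determine it; each of the 64 leaves is one landed profile theorem —
gen 22's `pathAccounting_long15_all` (the fourteen `N_p ≥ 15` profiles, through its disjunction), gen 22's `pathAccounting_profile14a … 1a` (45 profiles,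
`DenomLaw/Profile{14,…,5}Path*`, `ProfileLe4Path{A,B}`), gen 23's `pathAccounting_profile7c / 6a / 4b / 3a`, and `N_p = 0` = gen 6's shallow regime
(`pathAccounting_zero_j` below: (CV) without multipoles, `CasoratianLawNoMultipole`, now for every `j`).  Hypotheses a leaf needs that were not tested
on its branch follow from the tested ones and the sorted chain (`linarith`).  Four sub-assemblies of 16 leaves (`pathAccounting_a7_ss/sl/ls/ll`, by the
blocks `(1,7)` and `(2,7)` resp. `(1,6)`) keep each declaration small.  p-UNIFORM: no hypothesis names a prime or a depth; every leaf law was `decide`d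
on whole type lists of covers complete for every `p`.  Census beside the proof: the exhaustive type-level census at p ≤ 13 (kit j285126) has open = 0
on this stratum, as it must.  MODEL/structure-side valuation bookkeeping of the cell's own rationals (contiguity Casoratians of Brown–Zudilin dual
coefficients); the ∀-b node itself (a < 7: some parameter below `p`) stays `@[conjecture]`; nothing about ζ(5); no γ; records in print UNMOVED.
-/

open Finset

namespace Summit.KontsevichZagierPeriods.Zeta5Search.FullProfile

open Summit.KontsevichZagierPeriods.Zeta5Search.ClusterValuation
open Summit.KontsevichZagierPeriods.Zeta5Search.CasoratianValuation (InPolytope shift casoratian pairFloors refund)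
open Summit.KontsevichZagierPeriods.Zeta5Search.WedgeDictionary (dOf)
open Summit.KontsevichZagierPeriods.Zeta5Search.DenomLaw (cStar FirstPeriod Sorted7 BlockGe)
open Summit.KontsevichZagierPeriods.Zeta5Search.DenomLaw.FirstPeriodKit (sorted7_chain noMultipole_of_shallow pairFloors_eq_zero_of_shallow
  cStar_le_of_shallow shallow_pairs)

variable {b : ℕ → ℤ} {j p : ℕ}

/-! ## `N_p = 0` for every direction `j` (gen 6's shallow regime) -/

/-- **The node on the `N_p = 0` profile of the a = 7 stratum, every direction `j`**: no pair block reaches `p` (`b₀ < p + b₆ + b₇`), so no class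
has two poles and (CV) holds (`casoratianLaw_of_noMultipole`); `d < 2p` here since all parameters reach `p` (gen 6's `pathAccounting_shallow` is
the case `j = 7`). -/
theorem pathAccounting_zero_j (b : ℕ → ℤ) (j p : ℕ) (hb : InPolytope b) (hs : Sorted7 b) (hbj : InPolytope (shift b j))
    (hj1 : 1 ≤ j) (hj7 : j ≤ 7) (hprime : p.Prime) (hp5 : 5 ≤ p) (hwin : (b 0 + 2 : ℤ) < (p : ℤ) ^ 2) (_hfp : FirstPeriod b p)
    (hP : (p : ℤ) ≤ b 7) (h67 : b 0 < (p : ℤ) + b 6 + b 7) (hcas : casoratian b j ≠ 0) :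
    dOf b / (p : ℤ) - pairFloors b p - min (if 2 ≤ dOf b / (p : ℤ) then (1 : ℤ) else 0) (5 - (cStar b p : ℤ))
      ≤ padicValRat p (casoratian b j) := by
  haveI : Fact p.Prime := ⟨hprime⟩
  obtain ⟨h21, h32, h43, h54, h65, h76⟩ := sorted7_chain hs
  have hp0 : (0 : ℤ) < p := by exact_mod_cast hprime.pos
  have h67' : ¬ BlockGe b p 6 7 := by unfold BlockGe; push Not; linarith
  have hcv := ClusterValuation.casoratianLaw_of_noMultipole b hb hj1 hj7 hbj hp5 hwin (noMultipole_of_shallow hb hs hp5 h67') hcas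
  have hN := pairFloors_eq_zero_of_shallow hb hs h67'
  have hC : (cStar b p : ℤ) ≤ 5 := by exact_mod_cast (cStar_le_of_shallow (shallow_pairs hs h67')).2
  have hd0 : 0 ≤ dOf b / (p : ℤ) := Int.ediv_nonneg (by have := hb.2.2; unfold dOf; linarith) (by positivity)
  have hfd : dOf b / (p : ℤ) ≤ 1 := by
    have : dOf b < 2 * (p : ℤ) := by rw [DecompositionWholeCone.dOf_expand]; linarith
    have h2 : dOf b / (p : ℤ) < 2 := by rw [Int.ediv_lt_iff_lt_mul hp0]; linarith
    omega
  rw [hN, if_neg (by omega), min_eq_left (by linarith)]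
  unfold refund at hcv
  rw [hN, min_eq_right hfd] at hcv
  linarith

/-! ## The decision tree -/

/-- The a = 7 assembly on the branch `(1,7)` short, `(2,7)` short (16 profiles). -/
theorem pathAccounting_a7_ss (b : ℕ → ℤ) (j p : ℕ) (hb : InPolytope b) (hs : Sorted7 b) (hbj : InPolytope (shift b j))
    (hj1 : 1 ≤ j) (hj7 : j ≤ 7) (hprime : p.Prime) (hp5 : 5 ≤ p) (hwin : (b 0 + 2 : ℤ) < (p : ℤ) ^ 2) (hfp : FirstPeriod b p)
    (hP : (p : ℤ) ≤ b 7)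
    (g0 : b 0 < (p : ℤ) + b 2 + b 7) (hcas : casoratian b j ≠ 0) :
    dOf b / (p : ℤ) - pairFloors b p - min (if 2 ≤ dOf b / (p : ℤ) then (1 : ℤ) else 0) (5 - (cStar b p : ℤ))
      ≤ padicValRat p (casoratian b j) := by
  obtain ⟨h21, h32, h43, h54, h65, h76⟩ := sorted7_chain hs
  by_cases c1 : b 0 < (p : ℤ) + b 3 + b 7
  · by_cases c2 : b 0 < (p : ℤ) + b 4 + b 7
    · by_cases c3 : b 0 < (p : ℤ) + b 5 + b 7
      · by_cases c4 : b 0 < (p : ℤ) + b 6 + b 7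
        · exact pathAccounting_zero_j b j p hb hs hbj hj1 hj7 hprime hp5 hwin hfp hP c4 hcas
        push Not at c4
        exact pathAccounting_profile1a b j p hb hs hbj hj1 hj7 hprime hp5 hwin hfp hP (by linarith [c1, c2, c3, c4, g0] : b 0 < (p : ℤ) + b 5 + b 6) c3 c4 hcas
      push Not at c3
      by_cases c5 : b 0 < (p : ℤ) + b 5 + b 6
      · exact pathAccounting_profile2a b j p hb hs hbj hj1 hj7 hprime hp5 hwin hfp hP c5 c2 c3 hcas
      push Not at c5
      exact pathAccounting_profile3a b j p hb hs hbj hj1 hj7 hprime hp5 hwin hfp hP c2 c5 hcas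
    push Not at c2
    by_cases c6 : b 0 < (p : ℤ) + b 4 + b 6
    · by_cases c7 : b 0 < (p : ℤ) + b 5 + b 6
      · exact pathAccounting_profile3b b j p hb hs hbj hj1 hj7 hprime hp5 hwin hfp hP c7 c1 c2 hcas
      push Not at c7
      exact pathAccounting_profile4b b j p hb hs hbj hj1 hj7 hprime hp5 hwin hfp hP c1 c6 c2 c7 hcas
    push Not at c6
    by_cases c8 : b 0 < (p : ℤ) + b 4 + b 5
    · exact pathAccounting_profile5a b j p hb hs hbj hj1 hj7 hprime hp5 hwin hfp hP c1 c8 c6 hcas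
    push Not at c8
    exact pathAccounting_profile6a b j p hb hs hbj hj1 hj7 hprime hp5 hwin hfp hP c1 c8 hcas
  push Not at c1
  by_cases c9 : b 0 < (p : ℤ) + b 3 + b 6
  · by_cases c10 : b 0 < (p : ℤ) + b 4 + b 6
    · by_cases c11 : b 0 < (p : ℤ) + b 5 + b 6
      · exact pathAccounting_profile4a b j p hb hs hbj hj1 hj7 hprime hp5 hwin hfp hP c11 g0 c1 hcas
      push Not at c11
      exact pathAccounting_profile5d b j p hb hs hbj hj1 hj7 hprime hp5 hwin hfp hP g0 c9 c10 c1 c11 hcas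
    push Not at c10
    by_cases c12 : b 0 < (p : ℤ) + b 4 + b 5
    · exact pathAccounting_profile6d b j p hb hs hbj hj1 hj7 hprime hp5 hwin hfp hP g0 c9 c12 c1 c10 hcas
    push Not at c12
    exact pathAccounting_profile7c b j p hb hs hbj hj1 hj7 hprime hp5 hwin hfp hP g0 c9 c1 c12 hcas
  push Not at c9
  by_cases c13 : b 0 < (p : ℤ) + b 3 + b 5
  · by_cases c14 : b 0 < (p : ℤ) + b 4 + b 5
    · exact pathAccounting_profile7b b j p hb hs hbj hj1 hj7 hprime hp5 hwin hfp hP g0 c14 c9 hcas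
    push Not at c14
    exact pathAccounting_profile8b b j p hb hs hbj hj1 hj7 hprime hp5 hwin hfp hP g0 c13 c9 c14 hcas
  push Not at c13
  by_cases c15 : b 0 < (p : ℤ) + b 3 + b 4
  · exact pathAccounting_profile9b b j p hb hs hbj hj1 hj7 hprime hp5 hwin hfp hP g0 c15 c13 hcas
  push Not at c15
  exact pathAccounting_profile10a b j p hb hs hbj hj1 hj7 hprime hp5 hwin hfp hP g0 c15 hcas

/-- The a = 7 assembly on the branch `(1,7)` short, `(2,7)` long (16 profiles). -/
theorem pathAccounting_a7_sl (b : ℕ → ℤ) (j p : ℕ) (hb : InPolytope b) (hs : Sorted7 b) (hbj : InPolytope (shift b j))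
    (hj1 : 1 ≤ j) (hj7 : j ≤ 7) (hprime : p.Prime) (hp5 : 5 ≤ p) (hwin : (b 0 + 2 : ℤ) < (p : ℤ) ^ 2) (hfp : FirstPeriod b p)
    (hP : (p : ℤ) ≤ b 7)
    (g0 : b 0 < (p : ℤ) + b 1 + b 7) (g1 : (p : ℤ) + b 2 + b 7 ≤ b 0) (hcas : casoratian b j ≠ 0) :
    dOf b / (p : ℤ) - pairFloors b p - min (if 2 ≤ dOf b / (p : ℤ) then (1 : ℤ) else 0) (5 - (cStar b p : ℤ))
      ≤ padicValRat p (casoratian b j) := by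
  obtain ⟨h21, h32, h43, h54, h65, h76⟩ := sorted7_chain hs
  by_cases c1 : b 0 < (p : ℤ) + b 2 + b 6
  · by_cases c2 : b 0 < (p : ℤ) + b 3 + b 6
    · by_cases c3 : b 0 < (p : ℤ) + b 4 + b 6
      · by_cases c4 : b 0 < (p : ℤ) + b 5 + b 6
        · exact pathAccounting_profile5b b j p hb hs hbj hj1 hj7 hprime hp5 hwin hfp hP c4 g0 g1 hcas
        push Not at c4
        exact pathAccounting_profile6c b j p hb hs hbj hj1 hj7 hprime hp5 hwin hfp hP c3 g0 g1 c4 hcas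
      push Not at c3
      by_cases c5 : b 0 < (p : ℤ) + b 4 + b 5
      · exact pathAccounting_profile7d b j p hb hs hbj hj1 hj7 hprime hp5 hwin hfp hP g0 c2 c5 g1 c3 hcas
      push Not at c5
      exact pathAccounting_profile8c b j p hb hs hbj hj1 hj7 hprime hp5 hwin hfp hP g0 c2 g1 c5 hcas
    push Not at c2
    by_cases c6 : b 0 < (p : ℤ) + b 3 + b 5
    · by_cases c7 : b 0 < (p : ℤ) + b 4 + b 5
      · exact pathAccounting_profile8d b j p hb hs hbj hj1 hj7 hprime hp5 hwin hfp hP g0 c1 c7 g1 c2 hcas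
      push Not at c7
      exact pathAccounting_profile9e b j p hb hs hbj hj1 hj7 hprime hp5 hwin hfp hP g0 c1 c6 g1 c2 c7 hcas
    push Not at c6
    by_cases c8 : b 0 < (p : ℤ) + b 3 + b 4
    · exact pathAccounting_profile10e b j p hb hs hbj hj1 hj7 hprime hp5 hwin hfp hP g0 c1 c8 g1 c6 hcas
    push Not at c8
    exact pathAccounting_profile11c b j p hb hs hbj hj1 hj7 hprime hp5 hwin hfp hP g0 c1 g1 c8 hcas
  push Not at c1
  by_cases c9 : b 0 < (p : ℤ) + b 2 + b 5
  · by_cases c10 : b 0 < (p : ℤ) + b 3 + b 5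
    · by_cases c11 : b 0 < (p : ℤ) + b 4 + b 5
      · exact pathAccounting_profile9c b j p hb hs hbj hj1 hj7 hprime hp5 hwin hfp hP g0 c11 c1 hcas
      push Not at c11
      exact pathAccounting_profile10c b j p hb hs hbj hj1 hj7 hprime hp5 hwin hfp hP g0 c10 c1 c11 hcas
    push Not at c10
    by_cases c12 : b 0 < (p : ℤ) + b 3 + b 4
    · exact pathAccounting_profile11e b j p hb hs hbj hj1 hj7 hprime hp5 hwin hfp hP g0 c9 c12 c1 c10 hcas
    push Not at c12
    exact pathAccounting_profile12d b j p hb hs hbj hj1 hj7 hprime hp5 hwin hfp hP g0 c9 c1 c12 hcas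
  push Not at c9
  by_cases c13 : b 0 < (p : ℤ) + b 2 + b 4
  · by_cases c14 : b 0 < (p : ℤ) + b 3 + b 4
    · exact pathAccounting_profile12c b j p hb hs hbj hj1 hj7 hprime hp5 hwin hfp hP g0 c14 c9 hcas
    push Not at c14
    exact pathAccounting_profile13c b j p hb hs hbj hj1 hj7 hprime hp5 hwin hfp hP g0 c13 c9 c14 hcas
  push Not at c13
  by_cases c15 : b 0 < (p : ℤ) + b 2 + b 3
  · exact pathAccounting_profile14b b j p hb hs hbj hj1 hj7 hprime hp5 hwin hfp hP g0 c15 c13 hcas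
  push Not at c15
  exact pathAccounting_long15_all b j p hb hs hbj hj1 hj7 hprime hp5 hwin hfp hP (Or.inl c15) hcas

/-- The a = 7 assembly on the branch `(1,7)` long, `(1,6)` short (16 profiles). -/
theorem pathAccounting_a7_ls (b : ℕ → ℤ) (j p : ℕ) (hb : InPolytope b) (hs : Sorted7 b) (hbj : InPolytope (shift b j))
    (hj1 : 1 ≤ j) (hj7 : j ≤ 7) (hprime : p.Prime) (hp5 : 5 ≤ p) (hwin : (b 0 + 2 : ℤ) < (p : ℤ) ^ 2) (hfp : FirstPeriod b p)
    (hP : (p : ℤ) ≤ b 7)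
    (g0 : (p : ℤ) + b 1 + b 7 ≤ b 0) (g1 : b 0 < (p : ℤ) + b 1 + b 6) (hcas : casoratian b j ≠ 0) :
    dOf b / (p : ℤ) - pairFloors b p - min (if 2 ≤ dOf b / (p : ℤ) then (1 : ℤ) else 0) (5 - (cStar b p : ℤ))
      ≤ padicValRat p (casoratian b j) := by
  obtain ⟨h21, h32, h43, h54, h65, h76⟩ := sorted7_chain hs
  by_cases c1 : b 0 < (p : ℤ) + b 2 + b 6
  · by_cases c2 : b 0 < (p : ℤ) + b 3 + b 6
    · by_cases c3 : b 0 < (p : ℤ) + b 4 + b 6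
      · by_cases c4 : b 0 < (p : ℤ) + b 5 + b 6
        · exact pathAccounting_profile6b b j p hb hs hbj hj1 hj7 hprime hp5 hwin hfp hP c4 g0 hcas
        push Not at c4
        exact pathAccounting_profile7a b j p hb hs hbj hj1 hj7 hprime hp5 hwin hfp hP c3 g0 c4 hcas
      push Not at c3
      by_cases c5 : b 0 < (p : ℤ) + b 4 + b 5
      · exact pathAccounting_profile8a b j p hb hs hbj hj1 hj7 hprime hp5 hwin hfp hP c2 c5 g0 c3 hcas
      push Not at c5
      exact pathAccounting_profile9a b j p hb hs hbj hj1 hj7 hprime hp5 hwin hfp hP c2 g0 c5 hcas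
    push Not at c2
    by_cases c6 : b 0 < (p : ℤ) + b 3 + b 5
    · by_cases c7 : b 0 < (p : ℤ) + b 4 + b 5
      · exact pathAccounting_profile9d b j p hb hs hbj hj1 hj7 hprime hp5 hwin hfp hP c7 c1 g0 c2 hcas
      push Not at c7
      exact pathAccounting_profile10d b j p hb hs hbj hj1 hj7 hprime hp5 hwin hfp hP c1 c6 g0 c2 c7 hcas
    push Not at c6
    by_cases c8 : b 0 < (p : ℤ) + b 3 + b 4
    · exact pathAccounting_profile11b b j p hb hs hbj hj1 hj7 hprime hp5 hwin hfp hP c1 c8 g0 c6 hcas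
    push Not at c8
    exact pathAccounting_profile12b b j p hb hs hbj hj1 hj7 hprime hp5 hwin hfp hP c1 g0 c8 hcas
  push Not at c1
  by_cases c9 : b 0 < (p : ℤ) + b 2 + b 5
  · by_cases c10 : b 0 < (p : ℤ) + b 3 + b 5
    · by_cases c11 : b 0 < (p : ℤ) + b 4 + b 5
      · exact pathAccounting_profile10b b j p hb hs hbj hj1 hj7 hprime hp5 hwin hfp hP c11 g1 g0 c1 hcas
      push Not at c11
      exact pathAccounting_profile11d b j p hb hs hbj hj1 hj7 hprime hp5 hwin hfp hP g1 c10 g0 c1 c11 hcas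
    push Not at c10
    by_cases c12 : b 0 < (p : ℤ) + b 3 + b 4
    · exact pathAccounting_profile12e b j p hb hs hbj hj1 hj7 hprime hp5 hwin hfp hP g1 c9 c12 g0 c1 c10 hcas
    push Not at c12
    exact pathAccounting_profile13d b j p hb hs hbj hj1 hj7 hprime hp5 hwin hfp hP g1 c9 g0 c1 c12 hcas
  push Not at c9
  by_cases c13 : b 0 < (p : ℤ) + b 2 + b 4
  · by_cases c14 : b 0 < (p : ℤ) + b 3 + b 4
    · exact pathAccounting_profile13b b j p hb hs hbj hj1 hj7 hprime hp5 hwin hfp hP g1 c14 g0 c9 hcas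
    push Not at c14
    exact pathAccounting_profile14d b j p hb hs hbj hj1 hj7 hprime hp5 hwin hfp hP g1 c13 g0 c9 c14 hcas
  push Not at c13
  by_cases c15 : b 0 < (p : ℤ) + b 2 + b 3
  · exact pathAccounting_long15_all b j p hb hs hbj hj1 hj7 hprime hp5 hwin hfp hP (Or.inr (Or.inl ⟨g0, c13⟩)) hcas
  push Not at c15
  exact pathAccounting_long15_all b j p hb hs hbj hj1 hj7 hprime hp5 hwin hfp hP (Or.inl c15) hcas

/-- The a = 7 assembly on the branch `(1,7)` long, `(1,6)` long (16 profiles). -/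
theorem pathAccounting_a7_ll (b : ℕ → ℤ) (j p : ℕ) (hb : InPolytope b) (hs : Sorted7 b) (hbj : InPolytope (shift b j))
    (hj1 : 1 ≤ j) (hj7 : j ≤ 7) (hprime : p.Prime) (hp5 : 5 ≤ p) (hwin : (b 0 + 2 : ℤ) < (p : ℤ) ^ 2) (hfp : FirstPeriod b p)
    (hP : (p : ℤ) ≤ b 7)
    (g0 : (p : ℤ) + b 1 + b 6 ≤ b 0) (hcas : casoratian b j ≠ 0) :
    dOf b / (p : ℤ) - pairFloors b p - min (if 2 ≤ dOf b / (p : ℤ) then (1 : ℤ) else 0) (5 - (cStar b p : ℤ))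
      ≤ padicValRat p (casoratian b j) := by
  obtain ⟨h21, h32, h43, h54, h65, h76⟩ := sorted7_chain hs
  by_cases c1 : b 0 < (p : ℤ) + b 1 + b 5
  · by_cases c2 : b 0 < (p : ℤ) + b 2 + b 5
    · by_cases c3 : b 0 < (p : ℤ) + b 3 + b 5
      · by_cases c4 : b 0 < (p : ℤ) + b 4 + b 5
        · exact pathAccounting_profile11a b j p hb hs hbj hj1 hj7 hprime hp5 hwin hfp hP c4 g0 hcas
        push Not at c4
        exact pathAccounting_profile12a b j p hb hs hbj hj1 hj7 hprime hp5 hwin hfp hP c3 g0 c4 hcas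
      push Not at c3
      by_cases c5 : b 0 < (p : ℤ) + b 3 + b 4
      · exact pathAccounting_profile13a b j p hb hs hbj hj1 hj7 hprime hp5 hwin hfp hP c2 c5 g0 c3 hcas
      push Not at c5
      exact pathAccounting_profile14a b j p hb hs hbj hj1 hj7 hprime hp5 hwin hfp hP c2 g0 c5 hcas
    push Not at c2
    by_cases c6 : b 0 < (p : ℤ) + b 2 + b 4
    · by_cases c7 : b 0 < (p : ℤ) + b 3 + b 4
      · exact pathAccounting_profile14c b j p hb hs hbj hj1 hj7 hprime hp5 hwin hfp hP c1 c7 g0 c2 hcas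
      push Not at c7
      exact pathAccounting_long15_all b j p hb hs hbj hj1 hj7 hprime hp5 hwin hfp hP (Or.inr (Or.inr (Or.inl ⟨g0, c2, c7⟩))) hcas
    push Not at c6
    by_cases c8 : b 0 < (p : ℤ) + b 2 + b 3
    · exact pathAccounting_long15_all b j p hb hs hbj hj1 hj7 hprime hp5 hwin hfp hP (Or.inr (Or.inl ⟨(by linarith [c1, c2, c6, c8, g0] : (p : ℤ) + b 1 + b 7 ≤ b 0), c6⟩)) hcas
    push Not at c8
    exact pathAccounting_long15_all b j p hb hs hbj hj1 hj7 hprime hp5 hwin hfp hP (Or.inl c8) hcas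
  push Not at c1
  by_cases c9 : b 0 < (p : ℤ) + b 1 + b 4
  · by_cases c10 : b 0 < (p : ℤ) + b 2 + b 4
    · by_cases c11 : b 0 < (p : ℤ) + b 3 + b 4
      · exact pathAccounting_long15_all b j p hb hs hbj hj1 hj7 hprime hp5 hwin hfp hP (Or.inr (Or.inr (Or.inr c1))) hcas
      push Not at c11
      exact pathAccounting_long15_all b j p hb hs hbj hj1 hj7 hprime hp5 hwin hfp hP (Or.inr (Or.inr (Or.inl ⟨g0, (by linarith [c1, c9, c10, c11, g0] : (p : ℤ) + b 2 + b 5 ≤ b 0), c11⟩))) hcas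
    push Not at c10
    by_cases c12 : b 0 < (p : ℤ) + b 2 + b 3
    · exact pathAccounting_long15_all b j p hb hs hbj hj1 hj7 hprime hp5 hwin hfp hP (Or.inr (Or.inl ⟨(by linarith [c1, c9, c10, c12, g0] : (p : ℤ) + b 1 + b 7 ≤ b 0), c10⟩)) hcas
    push Not at c12
    exact pathAccounting_long15_all b j p hb hs hbj hj1 hj7 hprime hp5 hwin hfp hP (Or.inl c12) hcas
  push Not at c9
  by_cases c13 : b 0 < (p : ℤ) + b 1 + b 3
  · by_cases c14 : b 0 < (p : ℤ) + b 2 + b 3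
    · exact pathAccounting_long15_all b j p hb hs hbj hj1 hj7 hprime hp5 hwin hfp hP (Or.inr (Or.inl ⟨(by linarith [c1, c9, c13, c14, g0] : (p : ℤ) + b 1 + b 7 ≤ b 0), (by linarith [c1, c9, c13, c14, g0] : (p : ℤ) + b 2 + b 4 ≤ b 0)⟩)) hcas
    push Not at c14
    exact pathAccounting_long15_all b j p hb hs hbj hj1 hj7 hprime hp5 hwin hfp hP (Or.inl c14) hcas
  push Not at c13
  by_cases c15 : b 0 < (p : ℤ) + b 1 + b 2
  · exact pathAccounting_long15_all b j p hb hs hbj hj1 hj7 hprime hp5 hwin hfp hP (Or.inl (by linarith [c1, c9, c13, c15, g0] : (p : ℤ) + b 2 + b 3 ≤ b 0)) hcas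
  push Not at c15
  exact pathAccounting_long15_all b j p hb hs hbj hj1 hj7 hprime hp5 hwin hfp hP (Or.inl (by linarith [c1, c9, c13, c15, g0] : (p : ℤ) + b 2 + b 3 ≤ b 0)) hcas

/-- **THE a = 7 ASSEMBLY: `PathAccountingFirstPeriod`'s conclusion for EVERY sorted `b` with all seven parameters long (`p ≤ b₇`), every direction
`j`, every depth** — a decision tree over the pair-block ORDER conditions (depth 6, 64 leaves = the 64 profiles = the up-sets of the pair poset)
dispatching to the profile theorems of gens 6, 17, 18, 22, 23. -/
theorem pathAccounting_a7_all (b : ℕ → ℤ) (j p : ℕ) (hb : InPolytope b) (hs : Sorted7 b) (hbj : InPolytope (shift b j))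
    (hj1 : 1 ≤ j) (hj7 : j ≤ 7) (hprime : p.Prime) (hp5 : 5 ≤ p) (hwin : (b 0 + 2 : ℤ) < (p : ℤ) ^ 2) (hfp : FirstPeriod b p)
    (hP : (p : ℤ) ≤ b 7)
    (hcas : casoratian b j ≠ 0) :
    dOf b / (p : ℤ) - pairFloors b p - min (if 2 ≤ dOf b / (p : ℤ) then (1 : ℤ) else 0) (5 - (cStar b p : ℤ))
      ≤ padicValRat p (casoratian b j) := by
  by_cases c1 : b 0 < (p : ℤ) + b 1 + b 7
  · by_cases c2 : b 0 < (p : ℤ) + b 2 + b 7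
    · exact pathAccounting_a7_ss b j p hb hs hbj hj1 hj7 hprime hp5 hwin hfp hP c2 hcas
    · exact pathAccounting_a7_sl b j p hb hs hbj hj1 hj7 hprime hp5 hwin hfp hP c1 (by push Not at c2; exact c2) hcas
  · by_cases c2 : b 0 < (p : ℤ) + b 1 + b 6
    · exact pathAccounting_a7_ls b j p hb hs hbj hj1 hj7 hprime hp5 hwin hfp hP (by push Not at c1; exact c1) c2 hcas
    · exact pathAccounting_a7_ll b j p hb hs hbj hj1 hj7 hprime hp5 hwin hfp hP (by push Not at c2; exact c2) hcas

/-- **THE NODE ON THE WHOLE a = 7 STRATUM: `PathAccountingFirstPeriod` with its binders VERBATIM plus ONLY `p ≤ b₇`.** -/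
theorem pathAccountingFirstPeriod_a7_all :
    ∀ (b : ℕ → ℤ) (p : ℕ), InPolytope b → Sorted7 b → InPolytope (shift b 7) →
      p.Prime → 5 ≤ p → (b 0 + 2 : ℤ) < (p : ℤ) ^ 2 → FirstPeriod b p →
      (p : ℤ) ≤ b 7 → casoratian b 7 ≠ 0 →
        dOf b / (p : ℤ) - pairFloors b p - min (if 2 ≤ dOf b / (p : ℤ) then (1 : ℤ) else 0) (5 - (cStar b p : ℤ))
          ≤ padicValRat p (casoratian b 7) :=
  fun b p hb hs hb7 hprime hp5 hwin hfp hP hcas =>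
    pathAccounting_a7_all b 7 p hb hs hb7 (by norm_num) (by norm_num) hprime hp5 hwin hfp hP hcas

end Summit.KontsevichZagierPeriods.Zeta5Search.FullProfile
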